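import Summits.CriticalPhenomena.PercolationContinuityZ3.Theses.PercNonProliferation
import Literature.Probability.Percolation.SharpnessDCTProofs
import Literature.Probability.Percolation.FiniteEnergy
import Literature.Probability.Percolation.DeletionTolerance
import HarnessLib

/-!
# Crux `PercNonProliferation.SubpolynomialBlocking` (stmt-CriticalPhenomena-4446), line `cross-sandwich-flat-seal` — stub `stub_blockingDistanceTail`

Helper file for the lead's skeleton of the line `cross-sandwich-flat-seal` of the crux
`Summit.CriticalPhenomena.PercolationContinuityZ3.Theses.PercNonProliferation.SubpolynomialBlocking`.
Proves exactly the registered stub signature `stub_blockingDistanceTail`; lands with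
`--supports stmt-CriticalPhenomena-4446`.

Write `Λ_m = box 3 m`, `K = Λ_{2n}.sym2` (all unordered pairs of sites of `Λ_{2n}`) and
`Bl_n = {ω | ¬ ∃ x ∈ Λ_n, ∃ y ∈ ∂ⁱⁿ Λ_{2n}, x ⟷ y open inside Λ_{2n}}` (the annulus-blocking event of
the crux, `u_n(p) = P_p(Bl_n)`). The *blocking distance* `D_n(ω)` is the least number of open edges
one must close to reach `Bl_n`; the stub is the lower-tail estimate
`P_p(D_n ≤ j) = P_p(∃ F, |F| ≤ j, ω \ F ∈ Bl_n) ≤ ((|K| + 1) / (1 - p))^j · u_n(p)` for `p < 1`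
("blocking distance bounded with polynomial probability ⇒ polynomial blocking"). It is a
local-modification (finite-energy) estimate: no BK, no FKG.

## The argument (`StubBlockingDistanceTail.real_setOf_exists_diff_mem_le`, any graph)

For an event `A` determined by the states of the pairs in a finite set `K`
(`DeterminedBy A ↑K`; here `A = Bl_n`, `K = Λ_{2n}.sym2`, by `DCT16.determinedBy_openConnIn`):
* closing `F` or closing `F ∩ K` has the same effect on `A`, so
  `{∃ F, |F| ≤ j, ω \ F ∈ A} ⊆ ⋃_{F ⊆ K, |F| ≤ j} {ω | ω \ F ∈ A}`
  (`setOf_exists_subset_biUnion`);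
* for a fixed finite `F`, deletion tolerance of product measure
  (`bondPercolation_pow_mul_real_preimage_closeEdges_le`: `(1-p)^{|F|} P_p(ω \ F ∈ A) ≤ P_p(A)`,
  Grimmett 1999 §1.3) gives `P_p(ω \ F ∈ A) ≤ P_p(A) / (1-p)^j` when `|F| ≤ j`;
* the number of `F ⊆ K` with `|F| ≤ j` is `∑_{i ≤ j} C(|K|, i) ≤ ∑_{i ≤ j} |K|^i ≤ (|K|+1)^j`
  (`card_biUnion_powersetCard_le`), and a union bound finishes.

No new definitions; all sets are written exactly as in the registered signature.
-/

noncomputable section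

namespace Summit.CriticalPhenomena.PercolationContinuityZ3.Theorems.SubpolynomialBlocking

open MeasureTheory Filter Topology
open Literature.Probability.Percolation Literature.Probability.LatticeModels

namespace StubBlockingDistanceTail

/-! ### Counting the subsets of size at most `j` of a finite set -/

/-- `∑_{i ≤ j} m^i ≤ (m + 1)^j` (natural numbers). -/
theorem sum_range_pow_le_succ_pow (m j : ℕ) :
    ∑ i ∈ Finset.range (j + 1), m ^ i ≤ (m + 1) ^ j := by
  induction j with
  | zero => simp
  | succ j ih =>
    rw [Finset.sum_range_succ', pow_succ]
    have hmul : ∑ i ∈ Finset.range (j + 1), m ^ (i + 1) =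
        m * ∑ i ∈ Finset.range (j + 1), m ^ i := by
      rw [Finset.mul_sum]
      exact Finset.sum_congr rfl fun i _ => by ring
    rw [hmul, pow_zero]
    have h1 : 1 ≤ (m + 1) ^ j := Nat.one_le_pow _ _ (Nat.succ_pos m)
    nlinarith [ih, h1]

/-- The subsets of `K` of size at most `j`, listed as `⋃_{i ≤ j} {F ⊆ K, |F| = i}`, number at most
`∑_{i ≤ j} C(|K|, i) ≤ (|K| + 1)^j`. -/
theorem card_biUnion_powersetCard_le {α : Type*} [DecidableEq α] (K : Finset α) (j : ℕ) :
    ((Finset.range (j + 1)).biUnion fun i => K.powersetCard i).card ≤ (K.card + 1) ^ j :=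
  calc ((Finset.range (j + 1)).biUnion fun i => K.powersetCard i).card
      ≤ ∑ i ∈ Finset.range (j + 1), (K.powersetCard i).card := Finset.card_biUnion_le
    _ = ∑ i ∈ Finset.range (j + 1), K.card.choose i := by simp_rw [Finset.card_powersetCard]
    _ ≤ ∑ i ∈ Finset.range (j + 1), K.card ^ i :=
        Finset.sum_le_sum fun i _ => Nat.choose_le_pow _ _
    _ ≤ (K.card + 1) ^ j := sum_range_pow_le_succ_pow _ _

/-! ### Closing edges off the determining set is invisible -/

variable {V : Type*}

/-- Closing the pairs of `F` and closing only those of `F ∩ K` give configurations agreeing on `K`. -/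
theorem diff_inter_eq [DecidableEq V] (ω : BondConfig V) (F K : Finset (Sym2 V)) :
    (ω \ (↑F : Set (Sym2 V))) ∩ ↑K = (ω \ (↑(F ∩ K) : Set (Sym2 V))) ∩ ↑K := by
  ext e
  simp only [Set.mem_inter_iff, Set.mem_sdiff, Finset.coe_inter, Finset.mem_coe]
  tauto

/-- For an event `A` determined by the pairs in `K`, closing `F` or closing `F ∩ K` has the same
effect on membership in `A`. -/
theorem diff_mem_iff_of_determinedBy [DecidableEq V] {A : Set (BondConfig V)}
    {K : Finset (Sym2 V)} (hA : DeterminedBy A (↑K : Set (Sym2 V))) (ω : BondConfig V)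
    (F : Finset (Sym2 V)) :
    ω \ (↑F : Set (Sym2 V)) ∈ A ↔ ω \ (↑(F ∩ K) : Set (Sym2 V)) ∈ A :=
  (determinedBy_iff _ _).1 hA _ _ (diff_inter_eq ω F K)

/-- **Reduction to subsets of the determining set.** If `A` is determined by the pairs in `K`, the
event "closing some `≤ j` pairs puts `ω` in `A`" is contained in the finite union over
`F ⊆ K`, `|F| ≤ j`, of the events `{ω | ω \ F ∈ A}`. -/
theorem setOf_exists_subset_biUnion [DecidableEq V] {A : Set (BondConfig V)}
    {K : Finset (Sym2 V)} (hA : DeterminedBy A (↑K : Set (Sym2 V))) (j : ℕ) :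
    {ω : BondConfig V | ∃ F : Finset (Sym2 V), F.card ≤ j ∧ ω \ (↑F : Set (Sym2 V)) ∈ A} ⊆
      ⋃ F ∈ (Finset.range (j + 1)).biUnion (fun i => K.powersetCard i),
        {ω : BondConfig V | ω \ (↑F : Set (Sym2 V)) ∈ A} := by
  rintro ω ⟨F, hFj, hFA⟩
  simp only [Set.mem_iUnion, Finset.mem_biUnion, Finset.mem_range, Finset.mem_powersetCard,
    Set.mem_setOf_eq, exists_prop]
  exact ⟨F ∩ K, ⟨(F ∩ K).card,
    Nat.lt_succ_of_le ((Finset.card_le_card Finset.inter_subset_left).trans hFj),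
    Finset.inter_subset_right, rfl⟩, (diff_mem_iff_of_determinedBy hA ω F).1 hFA⟩

/-! ### The lower tail of the blocking distance of a finitely determined event -/

/-- **Lower tail of the "closing distance" to a finitely determined event.** For Bernoulli bond
percolation `P_p` on any graph with `p < 1`, an event `A` determined by the pairs in the finite set
`K`, and `j : ℕ`:
`P_p(∃ F, |F| ≤ j, ω \ F ∈ A) ≤ ((|K| + 1) / (1 - p))^j · P_p(A)`.
Union bound over the `≤ (|K|+1)^j` relevant sets `F ⊆ K` (`setOf_exists_subset_biUnion`,
`card_biUnion_powersetCard_le`) of the deletion-tolerance estimate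
`(1 - p)^{|F|} P_p(ω \ F ∈ A) ≤ P_p(A)` (`bondPercolation_pow_mul_real_preimage_closeEdges_le`,
Grimmett 1999 §1.3). -/
theorem real_setOf_exists_diff_mem_le [Countable V] [DecidableEq V] (G : SimpleGraph V)
    {p : unitInterval} (hp : (p : ℝ) < 1) {A : Set (BondConfig V)} {K : Finset (Sym2 V)}
    (hA : DeterminedBy A (↑K : Set (Sym2 V))) (j : ℕ) :
    (bondPercolation G p).real
        {ω : BondConfig V | ∃ F : Finset (Sym2 V), F.card ≤ j ∧ ω \ (↑F : Set (Sym2 V)) ∈ A} ≤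
      (((K.card : ℝ) + 1) / (1 - (p : ℝ))) ^ j * (bondPercolation G p).real A := by
  set μ := bondPercolation G p with hμ
  set S : Finset (Finset (Sym2 V)) :=
    (Finset.range (j + 1)).biUnion (fun i => K.powersetCard i) with hS
  have hq : 0 < 1 - (p : ℝ) := sub_pos.2 hp
  have hq1 : 1 - (p : ℝ) ≤ 1 := sub_le_self _ p.2.1
  have hAm : MeasurableSet A := hA.measurableSet_of_finset
  have hterm : ∀ F ∈ S,
      μ.real {ω : BondConfig V | ω \ (↑F : Set (Sym2 V)) ∈ A} ≤ μ.real A / (1 - (p : ℝ)) ^ j := by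
    intro F hF
    have hFj : F.card ≤ j := by
      simp only [hS, Finset.mem_biUnion, Finset.mem_range, Finset.mem_powersetCard] at hF
      obtain ⟨i, hi, -, hFi⟩ := hF
      omega
    have h1 : (1 - (p : ℝ)) ^ F.card * μ.real {ω : BondConfig V | ω \ (↑F : Set (Sym2 V)) ∈ A} ≤
        μ.real A :=
      bondPercolation_pow_mul_real_preimage_closeEdges_le G p F hAm
    rw [le_div_iff₀ (pow_pos hq j)]
    calc μ.real {ω : BondConfig V | ω \ (↑F : Set (Sym2 V)) ∈ A} * (1 - (p : ℝ)) ^ j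
        ≤ μ.real {ω : BondConfig V | ω \ (↑F : Set (Sym2 V)) ∈ A} * (1 - (p : ℝ)) ^ F.card :=
          mul_le_mul_of_nonneg_left (pow_le_pow_of_le_one hq.le hq1 hFj) measureReal_nonneg
      _ ≤ μ.real A := by rw [mul_comm]; exact h1
  have hcard : (S.card : ℝ) ≤ ((K.card : ℝ) + 1) ^ j := by
    exact_mod_cast card_biUnion_powersetCard_le K j
  calc μ.real {ω : BondConfig V | ∃ F : Finset (Sym2 V), F.card ≤ j ∧ ω \ (↑F : Set (Sym2 V)) ∈ A}
      ≤ μ.real (⋃ F ∈ S, {ω : BondConfig V | ω \ (↑F : Set (Sym2 V)) ∈ A}) :=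
        measureReal_mono (setOf_exists_subset_biUnion hA j) (measure_ne_top _ _)
    _ ≤ ∑ F ∈ S, μ.real {ω : BondConfig V | ω \ (↑F : Set (Sym2 V)) ∈ A} :=
        measureReal_biUnion_finset_le S _
    _ ≤ ∑ F ∈ S, μ.real A / (1 - (p : ℝ)) ^ j := Finset.sum_le_sum hterm
    _ = (S.card : ℝ) * (μ.real A / (1 - (p : ℝ)) ^ j) := by rw [Finset.sum_const, nsmul_eq_mul]
    _ ≤ ((K.card : ℝ) + 1) ^ j * (μ.real A / (1 - (p : ℝ)) ^ j) :=
        mul_le_mul_of_nonneg_right hcard (div_nonneg measureReal_nonneg (pow_nonneg hq.le _))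
    _ = (((K.card : ℝ) + 1) / (1 - (p : ℝ))) ^ j * μ.real A := by
        rw [div_pow]
        field_simp

/-! ### The annulus-blocking event is determined by the pairs of the outer box -/

/-- The annulus-blocking event `Bl_n = {¬ ∃ x ∈ Λ_n, ∃ y ∈ ∂ⁱⁿΛ_{2n}, x ⟷ y open inside Λ_{2n}}`
is determined by the states of the pairs of sites of `Λ_{2n}` (each `{x ⟷ y in Λ_{2n}}` is, by
`DCT16.determinedBy_openConnIn`). -/
theorem determinedBy_blockEvent (n : ℕ) :
    DeterminedBy {ω : BondConfig (Site 3) | ¬ ∃ x ∈ box 3 n,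
        ∃ y ∈ innerBoundary (zdGraph 3) (box 3 (2 * n)), ω ∈ openConnIn ↑(box 3 (2 * n)) x y}
      (↑(box 3 (2 * n)).sym2 : Set (Sym2 (Site 3))) := by
  rw [determinedBy_iff]
  intro ω ω' h
  have key : ∀ x y : Site 3,
      ω ∈ openConnIn (↑(box 3 (2 * n)) : Set (Site 3)) x y ↔
        ω' ∈ openConnIn (↑(box 3 (2 * n)) : Set (Site 3)) x y :=
    fun x y => (determinedBy_iff _ _).1
      (DCT16.determinedBy_openConnIn (↑(box 3 (2 * n)) : Set (Site 3)) x y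
        (K := (↑(box 3 (2 * n)).sym2 : Set (Sym2 (Site 3)))) (by rw [Finset.coe_sym2])) ω ω' h
  simp only [Set.mem_setOf_eq, key]

end StubBlockingDistanceTail

/-- **Stub `stub_blockingDistanceTail`** (line `cross-sandwich-flat-seal` of crux
`SubpolynomialBlocking`, stmt-CriticalPhenomena-4446): for every `p < 1` and all `n j`,
`P_p(∃ F, |F| ≤ j, ω \ F ∈ Bl_n) ≤ ((|Λ_{2n}.sym2| + 1) / (1 - p))^j · P_p(Bl_n)`, where
`Bl_n = {¬ ∃ x ∈ Λ_n, ∃ y ∈ ∂ⁱⁿΛ_{2n}, x ⟷ y open inside Λ_{2n}}` is the annulus-blocking event: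
the blocking probability controls the lower tail of the blocking distance. Instance of
`StubBlockingDistanceTail.real_setOf_exists_diff_mem_le` (deletion tolerance + union bound) with
`K = Λ_{2n}.sym2`, which determines `Bl_n` (`StubBlockingDistanceTail.determinedBy_blockEvent`). -/
theorem stub_blockingDistanceTail :
    ∀ (p : unitInterval), (p : ℝ) < 1 → ∀ n j : ℕ,
      (bondPercolation (zdGraph 3) p).real
          {ω | ∃ F : Finset (Sym2 (Site 3)), F.card ≤ j ∧
            ω \ (↑F : Set (Sym2 (Site 3))) ∈ {ω' : BondConfig (Site 3) | ¬ ∃ x ∈ box 3 n,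
              ∃ y ∈ innerBoundary (zdGraph 3) (box 3 (2 * n)), ω' ∈ openConnIn ↑(box 3 (2 * n)) x y}} ≤
        ((((box 3 (2 * n)).sym2.card : ℝ) + 1) / (1 - (p : ℝ))) ^ j *
          (bondPercolation (zdGraph 3) p).real
            {ω | ¬ ∃ x ∈ box 3 n, ∃ y ∈ innerBoundary (zdGraph 3) (box 3 (2 * n)),
              ω ∈ openConnIn ↑(box 3 (2 * n)) x y} := by
  intro p hp n j
  exact StubBlockingDistanceTail.real_setOf_exists_diff_mem_le (zdGraph 3) hp
    (StubBlockingDistanceTail.determinedBy_blockEvent n) j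

end Summit.CriticalPhenomena.PercolationContinuityZ3.Theorems.SubpolynomialBlocking

end
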